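import Summits.RiemannHypothesis.RiemannHypothesis.Theses.WeilWindowFlow
import Literature.NumberTheory.LFunctions.WeilWindowSuzukiContinuityProofs
import HarnessLib

/-!
# Route WeilWindowFlow — support item `WindowContinuity` (stmt-RiemannHypothesis-1041)

The window bottom `ε(a) = weilGroundEnergy a` (infimum of `Re Q(g)` over `L²`-normalised smooth test
functions `g` with `tsupport g ⊆ [-a, a]`) is continuous at every window `a > 0`.

This is exactly the tree theorem
`Literature.NumberTheory.LFunctions.continuousAt_weilGroundEnergy`
(`Literature/NumberTheory/LFunctions/WeilWindowSuzukiContinuityProofs.lean`), which discharges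
M. Suzuki, *Weil's quadratic form via the screw function*, arXiv:2606.09096, Thm. 1.3
(`Suzuki2026_thm_1_3_holds`; printed neighbour in the `L²`/parity class: Bombieri 2000, Thm. 5).
The proof there is minimiser-free: a uniform dilation modulus `|Re Q(g_η) − Re Q(g)| ≤ ε` over
energy-bounded normalised test functions of a window (`exists_weilDilate_modulus`), applied to
near-minimisers on both sides of `a₀`.
-/

namespace Summit.RiemannHypothesis.RiemannHypothesis.Theorems

/-- **Item `WindowContinuity` (stmt-RiemannHypothesis-1041) of route `WeilWindowFlow`, proved.**
For every `a > 0`, `weilGroundEnergy` is continuous at `a`; immediate from the tree theorem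
`Literature.NumberTheory.LFunctions.continuousAt_weilGroundEnergy` (Suzuki 2026, Thm. 1.3,
discharged in `WeilWindowSuzukiContinuityProofs.lean`). -/
theorem windowContinuity_proof :
    Summit.RiemannHypothesis.RiemannHypothesis.Theses.WeilWindowFlow.WindowContinuity := by
  unfold Summit.RiemannHypothesis.RiemannHypothesis.Theses.WeilWindowFlow.WindowContinuity
  intro a ha
  exact _root_.Literature.NumberTheory.LFunctions.continuousAt_weilGroundEnergy ha

end Summit.RiemannHypothesis.RiemannHypothesis.Theorems
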